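import Mathlib.Analysis.SpecialFunctions.Gamma.Digamma
import Mathlib.NumberTheory.LSeries.RiemannZeta
import Mathlib.MeasureTheory.Integral.IntervalIntegral.Basic
import Mathlib.Analysis.SpecialFunctions.Pow.Complex
import Literature.NumberTheory.LFunctions.ZetaZeros
import HarnessLib

-- provenance: harness21/H21/H21/Prelude/AntSieve/RiemannSiegel.lean @ 884d84e (interim HEAD d8f2665); M5 mechanical rewrite
/-!
# Riemann–Siegel theta function, Hardy's `Z`-function, and `S(T)`

Trunk `AntSieve` (analytic number theory / sieves), prelude item C5 `RiemannSiegel`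
(outline `H21/Outlines/AntSieve.md`, decision D-ANT-3; notion `riemann_siegel_theta_S`).

## Contents

* `Literature.riemannSiegelTheta t = θ(t)`: the Riemann–Siegel theta function, the continuous branch of
  `Im log Γ(1/4 + it/2) − (t/2) log π` with `θ(0) = 0`.
* `Literature.hardyZ t = Z(t) = e^{iθ(t)} ζ(1/2 + it)`, Hardy's function (real-valued for real `t`).
* `Literature.zetaArgS T = S(T)`: the argument term of the Riemann–von Mangoldt formula, in Backlund's
  form `S(T) = N(T) − θ(T)/π − 1`.
* API: `θ(0) = 0`, `θ` odd, smooth, its derivative, the `Γ`-ratio phase identity, reality of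
  `e^{iθ} ζ(1/2+it)`, `|Z(t)| = |ζ(1/2+it)|`, `Z` even, zeros of `Z`, `S(T) = O(log T)`, Stirling
  asymptotics of `θ`.

## Mathlib

Mathlib has `Complex.digamma = logDeriv Gamma` (`SpecialFunctions/Gamma/Digamma.lean`),
`Complex.Gamma`, `riemannZeta`, `intervalIntegral`; it has no `log Γ` branch, no Riemann–Siegel
theta, no Hardy `Z` and no `S(T)` (searched `Siegel`, `hardyZ`, `theta` in `NumberTheory`).

## Design choices

* (D-ANT-3) A continuous branch of `arg Γ(1/4 + it/2)` is obtained *by construction* as the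
  integral of its derivative: since `d/dt Im log Γ(1/4 + it/2) = Re ψ(1/4 + it/2) / 2` with
  `ψ = Γ'/Γ = Complex.digamma`, we set
  `θ(t) := ∫₀ᵗ (Re ψ(1/4 + iu/2) / 2 − (log π)/2) du`. No choice of logarithm enters; `θ(0) = 0`
  and oddness are immediate from `Re ψ(s̄) = Re ψ(s)`.
* `Z(t)` is defined as the *real part* of `e^{iθ(t)} ζ(1/2 + it)`; that this complex number is
  already real is the (sorried) lemma `im_cexp_theta_mul_zeta_eq_zero` (functional equation).
* `S(T)` is *defined* by Backlund's identity `S(T) := N(T) − θ(T)/π − 1` rather than as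
  `(1/π) arg ζ(1/2 + iT)` by continuous variation along `2 → 2 + iT → 1/2 + iT`; the two agree for
  `T` not an ordinate (Titchmarsh Thm. 9.3). With the box convention `Im ρ ≤ T` of
  `Literature.NumberTheory.LFunctions.zetaZeroCount` (right-continuous `N`), at an ordinate `T = γ` our `zetaArgS T` equals
  `S(T + 0)`, whereas Titchmarsh §9.3 takes the average `(S(T+0) + S(T−0))/2` there. This only
  affects the values on the (countable) set of ordinates and none of the `O`-statements.

## References

* E. C. Titchmarsh, *The Theory of the Riemann Zeta-Function*, 2nd ed. (1986), §4.17 (`θ`, `Z`,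
  Riemann–Siegel formula), §9.3–9.4 (`S(T)`, Backlund, `S(T) = O(log T)`).
* H. M. Edwards, *Riemann's Zeta Function* (1974), ch. 6 (`θ`, `Z`, Stirling expansion of `θ`),
  ch. 7 (Riemann–Siegel formula).
* R. J. Backlund, *Über die Nullstellen der Riemannschen Zetafunktion*, Acta Math. 41 (1916/1918),
  345–375. [Backlund1916Nullstellen]
* H. von Mangoldt, *Zur Verteilung der Nullstellen der Riemannschen Funktion ξ(t)*, Math. Ann. 60
  (1905), 1–19. [vonMangoldt1905]
* G. H. Hardy, *Sur les zéros de la fonction ζ(s) de Riemann*, C. R. Acad. Sci. Paris 158 (1914),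
  1012–1014. [Hardy1914CR]
Bib keys used in tags: [Titchmarsh1986], [Edwards1974].
-/

noncomputable section

open Complex Filter Set Asymptotics
open scoped Real Topology

namespace Literature.NumberTheory.LFunctions

/-! ## The Riemann–Siegel theta function -/

/-- The integrand of the Riemann–Siegel theta function, i.e. its derivative
`θ'(t) = Re ψ(1/4 + it/2) / 2 − (log π) / 2`, where `ψ = Γ'/Γ = Complex.digamma`.
(Edwards §6.5; Titchmarsh §4.17.) [folklore] -/
def riemannSiegelThetaDeriv (u : ℝ) : ℝ :=
  (Complex.digamma (1 / 4 + u / 2 * I)).re / 2 - Real.log π / 2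

/-- The **Riemann–Siegel theta function** `θ(t) = Im log Γ(1/4 + it/2) − (t/2) log π`
(continuous branch with `θ(0) = 0`), defined as `∫₀ᵗ θ'(u) du` with
`θ'(u) = Re ψ(1/4 + iu/2)/2 − (log π)/2` (outline D-ANT-3), so that no branch of the logarithm has
to be chosen. (Titchmarsh §4.17; Edwards §6.5.) [folklore] -/
def riemannSiegelTheta (t : ℝ) : ℝ :=
  ∫ u in (0 : ℝ)..t, riemannSiegelThetaDeriv u

/-- **Hardy's `Z`-function** `Z(t) = e^{iθ(t)} ζ(1/2 + it)`, real for real `t`; we take the real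
part of the right-hand side (its imaginary part vanishes, `im_cexp_theta_mul_zeta_eq_zero`).
(Hardy 1914; Titchmarsh §4.17, eq. (4.17.2); Edwards §6.5.)
[cite: Titchmarsh1986, §4.17, eq. (4.17.2)] -/
def hardyZ (t : ℝ) : ℝ :=
  (cexp (riemannSiegelTheta t * I) * riemannZeta (1 / 2 + t * I)).re

/-- **`S(T)`**, the argument term in the Riemann–von Mangoldt formula
`N(T) = θ(T)/π + 1 + S(T)`, *defined* by Backlund's form `S(T) := N(T) − θ(T)/π − 1`
(Titchmarsh Thm. 9.3, eq. (9.3.2)). For `T` not the ordinate of a zero this equals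
`(1/π) arg ζ(1/2 + iT)` obtained by continuous variation along the segments
`2 → 2 + iT → 1/2 + iT` starting from `arg ζ(2) = 0`. **Convention at ordinates:** since
`Literature.NumberTheory.LFunctions.zetaZeroCount` counts zeros with `Im ρ ≤ T` (so `N(T) = N(T+0)`), at an ordinate `T = γ`
this definition gives `S(T + 0)`, whereas Titchmarsh §9.3 defines `S(γ)` as the average
`(S(γ+0) + S(γ−0))/2`. (Backlund 1916/18; Titchmarsh §9.3, eq. (9.3.1)–(9.3.2); outline
D-ANT-3.)
[cite: Titchmarsh1986, §9.3, Thm. 9.3 (9.3.2)] -/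
def zetaArgS (T : ℝ) : ℝ :=
  zetaZeroCount T - riemannSiegelTheta T / π - 1

/-! ## API for `θ` -/

/-- `θ(0) = 0`. [folklore] -/
@[simp]
theorem riemannSiegelTheta_zero : riemannSiegelTheta 0 = 0 := by
  simp [riemannSiegelTheta]

/-- The integrand `θ'` is even: `Re ψ(1/4 − iu/2) = Re ψ(1/4 + iu/2)` since
`ψ(s̄) = conj ψ(s)` (standard; cf. Edwards §6.5). [folklore] -/
def riemannSiegelThetaDeriv_neg : Prop :=
  ∀ (u : ℝ),
    riemannSiegelThetaDeriv (-u) = riemannSiegelThetaDeriv u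

/-- The integrand `θ'` is continuous (`ψ` is holomorphic off the non-positive integers, and
`Re (1/4 + iu/2) = 1/4`; standard). [folklore] -/
def continuous_riemannSiegelThetaDeriv : Prop :=
  Continuous riemannSiegelThetaDeriv

/-- `θ` is odd: `θ(−t) = −θ(t)` (Edwards §7.2, p. 138, "using `ϑ(−t) = −ϑ(t)`";
Titchmarsh §4.17, `χ(½+it)χ(½−it) = 1`). [cite: Edwards1974, §7.2 (p. 138) with §6.5] -/
def riemannSiegelTheta_neg : Prop :=
  ∀ (t : ℝ),
    riemannSiegelTheta (-t) = -riemannSiegelTheta t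

/-- `θ` is smooth (indeed real-analytic) on `ℝ` (standard: `ψ` is holomorphic on `re s > 0`;
cf. Edwards §6.5). [folklore] -/
def contDiff_riemannSiegelTheta : Prop :=
  ∀ {n : WithTop ℕ∞},
    ContDiff ℝ n riemannSiegelTheta

/-- `θ'(t) = Re ψ(1/4 + it/2)/2 − (log π)/2` (fundamental theorem of calculus applied to the
defining integral; standard, cf. Edwards §6.5, `ϑ'(t) ∼ ½ log (t/2π)`). [folklore] -/
def hasDerivAt_riemannSiegelTheta : Prop :=
  ∀ (t : ℝ),
    HasDerivAt riemannSiegelTheta (riemannSiegelThetaDeriv t) t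

/-- The phase identity `e^{iθ(t)} = π^{−it/2} Γ(1/4 + it/2) / |Γ(1/4 + it/2)|`, i.e. `θ` is a
continuous branch of `arg (π^{−it/2} Γ(1/4 + it/2))`. (Titchmarsh §4.17, the display between
(4.17.2) and (4.17.3): `{χ(½+it)}^{-1/2} = π^{-it/2} Γ(¼+½it)/|Γ(¼+½it)|`; Edwards §6.5.)
[cite: Titchmarsh1986, §4.17, between (4.17.2) and (4.17.3)] -/
def cexp_riemannSiegelTheta_mul_I : Prop :=
  ∀ (t : ℝ),
    cexp (riemannSiegelTheta t * I) =
      (π : ℂ) ^ (-(t : ℂ) * I / 2) * Complex.Gamma (1 / 4 + t / 2 * I) /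
        ‖Complex.Gamma (1 / 4 + t / 2 * I)‖

/-- Stirling asymptotics of `θ`:
`θ(t) = (t/2) log (t / 2π) − t/2 − π/8 + O(1/t)` as `t → ∞`.
(Edwards §6.5, eq. (1), p. 120: `ϑ(t) = (t/2) log (t/2π) − t/2 − π/8 + 1/(48t) + …`;
Titchmarsh §4.17.)
[cite: Edwards1974, §6.5, eq. (1)] -/
def isBigO_riemannSiegelTheta_sub_stirling : Prop :=
  (fun t : ℝ ↦ riemannSiegelTheta t - (t / 2 * Real.log (t / (2 * π)) - t / 2 - π / 8))
      =O[atTop] fun t : ℝ ↦ t⁻¹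

/-! ## API for `Z` -/

/-- `e^{iθ(t)} ζ(1/2 + it)` is real: its imaginary part vanishes (from the functional equation in
the symmetric form `π^{-s/2} Γ(s/2) ζ(s) = π^{-(1-s)/2} Γ((1-s)/2) ζ(1-s)` and
`cexp_riemannSiegelTheta_mul_I`; Titchmarsh §4.17, after (4.17.3): "The function `Z(t)` is thus
real for real `t`"; Edwards §6.5, footnote p. 119). [cite: Titchmarsh1986, §4.17, after (4.17.3)] -/
def im_cexp_theta_mul_zeta_eq_zero : Prop :=
  ∀ (t : ℝ),
    (cexp (riemannSiegelTheta t * I) * riemannZeta (1 / 2 + t * I)).im = 0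

/-- `Z(t)` coerced to `ℂ` is `e^{iθ(t)} ζ(1/2 + it)`. [folklore] -/
def ofReal_hardyZ : Prop :=
  ∀ (t : ℝ),
    (hardyZ t : ℂ) = cexp (riemannSiegelTheta t * I) * riemannZeta (1 / 2 + t * I)

/- interim proof relied on results that are now named facts (D-0014); demoted to a fact by the M5 import, proof preserved:
:= by
  apply Complex.ext
  · rw [ofReal_re, hardyZ]
  · rw [ofReal_im, im_cexp_theta_mul_zeta_eq_zero t]
-/

/-- `|Z(t)| = |ζ(1/2 + it)|`. (Titchmarsh §4.17.) [folklore] -/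
def abs_hardyZ_eq_norm_riemannZeta : Prop :=
  ∀ (t : ℝ),
    |hardyZ t| = ‖riemannZeta (1 / 2 + t * I)‖

/- interim proof relied on results that are now named facts (D-0014); demoted to a fact by the M5 import, proof preserved:
:= by
  rw [← Real.norm_eq_abs, ← Complex.norm_real, ofReal_hardyZ, norm_mul,
    Complex.norm_exp_ofReal_mul_I, one_mul]
-/

/-- `Z` is even: `Z(−t) = Z(t)` (from `θ` odd and `ζ(s̄) = conj ζ(s)`; standard, cf. Edwards
§6.5–§7.2). [folklore] -/
def hardyZ_neg : Prop :=
  ∀ (t : ℝ),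
    hardyZ (-t) = hardyZ t

/-- `Z(t) = 0 ↔ ζ(1/2 + it) = 0`: the real zeros of `Z` are exactly the zeros of `ζ` on the
critical line. (Titchmarsh §4.17.) [folklore] -/
def hardyZ_eq_zero_iff : Prop :=
  ∀ (t : ℝ),
    hardyZ t = 0 ↔ riemannZeta (1 / 2 + t * I) = 0

/- interim proof relied on results that are now named facts (D-0014); demoted to a fact by the M5 import, proof preserved:
:= by
  rw [← abs_eq_zero, abs_hardyZ_eq_norm_riemannZeta, norm_eq_zero]
-/

/-! ## API for `S(T)` -/

/-- Backlund's form of the Riemann–von Mangoldt formula, by definition of `zetaArgS`: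
`N(T) = θ(T)/π + 1 + S(T)`. (Titchmarsh Thm. 9.3.) [folklore] -/
theorem zetaZeroCount_eq_theta_add_zetaArgS (T : ℝ) :
    (zetaZeroCount T : ℝ) = riemannSiegelTheta T / π + 1 + zetaArgS T := by
  simp only [zetaArgS]
  ring

/-- `S(T) = O(log T)` as `T → ∞` (von Mangoldt 1905; Backlund 1916/18; Titchmarsh Thm. 9.4,
eq. (9.4.2)). [cite: Titchmarsh1986, Thm. 9.4 (9.4.2)] -/
def isBigO_zetaArgS_log : Prop :=
  zetaArgS =O[atTop] Real.log

end Literature.NumberTheory.LFunctions
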